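/-
Copyright: the b2b-balaban T⁴-continuum CRUX team, row NE7b OWNER lineage `t4-ne7b-p1` (gen 128). Project licence.
-/
import Summits.QuantumFields.BalabanUV.T4Continuum.Spine.NE7b.SupRegulatorFlowSummable

/-!
# A MARGIN SCHEDULE FOR GEOMETRIC SCALES: if the scale covariances decay geometrically (`Γ_j ⪯ (K₀∕4^j)·1`, as (284)'s `K_N = O(4^{−N})`)
# and the regulator strength is small at the FIRST scale (`0 < κ`, `e·κK₀·(4∕3) ≤ ½`), then the margins `θ_j = e·κK₀∕4^j` satisfy ALL the
# hypotheses of (301)∕(302) — `0 < θ_j ≤ ½`, `Σ_{j<n}θ_j ≤ ½`, and the grown subcriticality `(Π_{i<j}(1−θ_i)⁻¹)·κ·(K₀∕4^j) ≤ θ_j` — so the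
# regulator flow runs through every scale with total loss `e`: `‖K_n(φ)‖ ≤ A·e^{e·tr(M·Σ_{j<n}Γ_j)}·e^{½e·φᵀMφ}` for all `n`
# (row NE7b, node U5c; (302) BY NAME + the geometric series; [folklore])

Cell `pub-balaban`, sub-cell `t4`, spine estimate NE7b (`T4WeightBudget.RelWeightBound`; the cell's OWN estimate — NOT PRINTED in
[Bałaban 1983–89], NOT PROVED).  Crux-route work under `Spine/NE7b/` by the row OWNER (`t4-ne7b-p1` gen 128, file (303)) under FREEZE
(0)'s crux-prover clause, on § [NE7bP1-G127-HANDOFF] NEXT (3)(b)∕(e); NOTHING of Bałaban's is named as a Lean object, valued or asserted; no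
`T4Continuum/Support` leaf typed; no `def`, no notation; zero `sorry`.  Imports (BY NAME): the OWNER's (302) `…SupRegulatorFlowSummable`
(`regulator_flow_summable`, `prod_inv_one_sub_le_exp`); Mathlib's `geom_sum_eq`, `Real.exp_one_lt_d9`, `Real.add_one_le_exp`.

WHY (located).  (301)∕(302) carry the hypotheses «grown subcriticality at every step» and «summable margins»; for the road's scales the
covariance bounds are geometric ((284)∕(291): `K_N = c·π⁴∕(4·4^N·(cmp)²)`), so both hypotheses reduce to ONE smallness condition at the first
scale.  This file makes that arithmetic explicit, closing the loop: the regulated class of gen 128 is stable along ALL scales of (280)'s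
split once `κK₀` is small.

WHAT IS PROVED ([folklore]; `θ_j = e·κK₀∕4^j`):
* §1 `geom_quarter_sum_le` (`Σ_{j<n}4^{−j} ≤ 4∕3`), `schedule_pos`, `schedule_le_half`, `schedule_sum_le_half`, `schedule_growth_le`
  (`Π_{i<j}(1−θ_i)⁻¹ ≤ e`), **`schedule_subcritical`** (`(Π_{i<j}(1−θ_i)⁻¹)·κ·(K₀∕4^j) ≤ θ_j`);
* §2 THE END **`regulator_flow_geometric`** (for `Γ_j ⪰ 0` with `Γ_j ⪯ (K₀∕4^j)·1`, `0 ⪯ M ⪯ κ·1`, `0 < κ`, `0 < K₀`, `e·κK₀·(4∕3) ≤ ½`, and a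
  flow `K_{j+1}(φ) = ∫K_j(x+φ)dN(0,Γ_j)` from `‖K_0(x)‖ ≤ Ae^{½xᵀMx}`: `‖K_n(φ)‖ ≤ A·e^{e·tr(M·Σ_{j<n}Γ_j)}·e^{½e·φᵀMφ}` for every `n, φ`); §3 toy.

HONEST (what this is NOT).  Arithmetic on (302); the road's `K₀` is (291)'s `K_0 = c·π⁴∕(4(cmp)²)` and the smallness `e·κK₀·(4∕3) ≤ ½` joins
(290)'s `κ ≥ λ+Λ` into the single window `(λ+Λ)·K₀ ≲ 1∕8` (stability loss × fluctuation size small) — stated, not optimised; scalar skeleton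
((A3), NC-NE7b-α UNRULED); nothing of Bałaban's asserted.  BY-NAME EFFECT ON THE WALL: NONE.  NE7b NOT PRINTED ∕ NOT PROVED; spine PROVED 0∕9;
rung (B)+1 — the programme's measures remain FINITE-torus statements; NOT the mass gap, NOT Clay.  HONEST DEPENDENCY: continuum YM on T⁴ ⇐
BetaPertH ∧ nine spine estimates (0∕9 proved); BetaPertH ⇐ (D1) ∧ (D4) ∧ CAP+tail; G-an2-4 gates asym, D1 and NE2∕3∕4.
-/

set_option autoImplicit false

noncomputable section

namespace Summit.QuantumFields.BalabanUV.T4Continuum.NE7b.SupMarginSchedule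

open MeasureTheory ProbabilityTheory Matrix Real WithLp Finset
open scoped BigOperators
open SupRegulatorFlowSummable (regulator_flow_summable prod_inv_one_sub_le_exp)

variable {ι : Type*} [Fintype ι] [DecidableEq ι]

/-! ## §1. The schedule `θ_j = e·κK₀∕4^j` -/

/-- `Σ_{j<n}(1∕4)^j ≤ 4∕3`. [folklore] -/
theorem geom_quarter_sum_le (n : ℕ) : ∑ j ∈ range n, ((1 : ℝ) / 4) ^ j ≤ 4 / 3 := by
  have h := geom_sum_eq (x := (1 : ℝ) / 4) (by norm_num) n
  rw [h]
  have hp : (0 : ℝ) ≤ ((1 : ℝ) / 4) ^ n := pow_nonneg (by norm_num) n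
  rw [div_le_iff_of_neg (by norm_num)]
  linarith

/-- `1∕4^j = (1∕4)^j` bookkeeping. [folklore] -/
theorem one_div_four_pow (j : ℕ) : (1 : ℝ) / 4 ^ j = ((1 : ℝ) / 4) ^ j := by
  rw [div_pow, one_pow]

/-- The schedule is positive for `κ, K₀ > 0`. [folklore] -/
theorem schedule_pos {κ K₀ : ℝ} (hκ : 0 < κ) (hK : 0 < K₀) (j : ℕ) : 0 < exp 1 * κ * K₀ / 4 ^ j := by positivity

/-- The schedule is `≤ ½` under `e·κK₀·(4∕3) ≤ ½`. [folklore] -/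
theorem schedule_le_half {κ K₀ : ℝ} (hκ : 0 < κ) (hK : 0 < K₀) (hsmall : exp 1 * κ * K₀ * (4 / 3) ≤ 1 / 2) (j : ℕ) :
    exp 1 * κ * K₀ / 4 ^ j ≤ 1 / 2 := by
  have h4 : (1 : ℝ) ≤ 4 ^ j := one_le_pow₀ (by norm_num)
  have hpos : 0 < exp 1 * κ * K₀ := by positivity
  calc exp 1 * κ * K₀ / 4 ^ j ≤ exp 1 * κ * K₀ / 1 := div_le_div_of_nonneg_left hpos.le one_pos h4
    _ ≤ 1 / 2 := by rw [div_one]; nlinarith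

/-- The schedule sums to `≤ ½`. [folklore] -/
theorem schedule_sum_le_half {κ K₀ : ℝ} (hκ : 0 < κ) (hK : 0 < K₀) (hsmall : exp 1 * κ * K₀ * (4 / 3) ≤ 1 / 2) (n : ℕ) :
    ∑ j ∈ range n, exp 1 * κ * K₀ / 4 ^ j ≤ 1 / 2 := by
  have hpos : 0 < exp 1 * κ * K₀ := by positivity
  have h : ∑ j ∈ range n, exp 1 * κ * K₀ / 4 ^ j = exp 1 * κ * K₀ * ∑ j ∈ range n, ((1 : ℝ) / 4) ^ j := by
    rw [mul_sum]
    exact sum_congr rfl fun j _ => by rw [← one_div_four_pow]; ring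
  rw [h]
  calc exp 1 * κ * K₀ * ∑ j ∈ range n, ((1 : ℝ) / 4) ^ j ≤ exp 1 * κ * K₀ * (4 / 3) :=
        mul_le_mul_of_nonneg_left (geom_quarter_sum_le n) hpos.le
    _ ≤ 1 / 2 := hsmall

/-- **THE GROWTH ALONG THE SCHEDULE IS `≤ e`.** [folklore] -/
theorem schedule_growth_le {κ K₀ : ℝ} (hκ : 0 < κ) (hK : 0 < K₀) (hsmall : exp 1 * κ * K₀ * (4 / 3) ≤ 1 / 2) (j : ℕ) :
    ∏ i ∈ range j, (1 - exp 1 * κ * K₀ / 4 ^ i)⁻¹ ≤ exp 1 := by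
  refine (prod_inv_one_sub_le_exp (fun i => exp 1 * κ * K₀ / 4 ^ i) (fun i => (schedule_pos hκ hK i).le)
    (fun i => schedule_le_half hκ hK hsmall i) j).trans (exp_le_exp.2 ?_)
  linarith [schedule_sum_le_half hκ hK hsmall j]

/-- **THE SCHEDULE IS SUBCRITICAL AT EVERY STEP FOR THE GROWN REGULATOR**: `(Π_{i<j}(1−θ_i)⁻¹)·κ·(K₀∕4^j) ≤ θ_j = e·κK₀∕4^j`. [folklore] -/
theorem schedule_subcritical {κ K₀ : ℝ} (hκ : 0 < κ) (hK : 0 < K₀) (hsmall : exp 1 * κ * K₀ * (4 / 3) ≤ 1 / 2) (j : ℕ) :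
    (∏ i ∈ range j, (1 - exp 1 * κ * K₀ / 4 ^ i)⁻¹) * κ * (K₀ / 4 ^ j) ≤ exp 1 * κ * K₀ / 4 ^ j := by
  have hg := schedule_growth_le hκ hK hsmall j
  have hpos : 0 ≤ κ * (K₀ / 4 ^ j) := by positivity
  calc (∏ i ∈ range j, (1 - exp 1 * κ * K₀ / 4 ^ i)⁻¹) * κ * (K₀ / 4 ^ j)
      = (∏ i ∈ range j, (1 - exp 1 * κ * K₀ / 4 ^ i)⁻¹) * (κ * (K₀ / 4 ^ j)) := by ring
    _ ≤ exp 1 * (κ * (K₀ / 4 ^ j)) := mul_le_mul_of_nonneg_right hg hpos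
    _ = exp 1 * κ * K₀ / 4 ^ j := by ring

/-! ## §2. THE END: the regulator flow through geometric scales -/

/-- **THE REGULATOR FLOW RUNS THROUGH EVERY GEOMETRIC SCALE WITH TOTAL LOSS `e`.**  `Γ_j ⪰ 0` with `Γ_j ⪯ (K₀∕4^j)·1` (`K₀ > 0`); `0 ⪯ M ⪯ κ·1`
with `0 < κ` and the first-scale smallness `e·κK₀·(4∕3) ≤ ½`; a flow `K_{j+1}(φ) = ∫K_j(x+φ)dN(0,Γ_j)` from `‖K_0(x)‖ ≤ A·e^{½xᵀMx}` (`A ≥ 0`)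
⟹ for every `n` and `φ`: `‖K_n(φ)‖ ≤ A·e^{e·tr(M·Σ_{j<n}Γ_j)}·e^{½e·φᵀMφ}`. [folklore] -/
theorem regulator_flow_geometric {E : Type*} [NormedAddCommGroup E] [NormedSpace ℝ E] (Γ : ℕ → Matrix ι ι ℝ) {M : Matrix ι ι ℝ}
    {κ K₀ A : ℝ} (hΓ : ∀ j, (Γ j).PosSemidef) (hΓop : ∀ j, ((K₀ / 4 ^ j) • (1 : Matrix ι ι ℝ) - Γ j).PosSemidef)
    (hM : M.PosSemidef) (hMκ : (κ • (1 : Matrix ι ι ℝ) - M).PosSemidef) (hκ : 0 < κ) (hK : 0 < K₀)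
    (hsmall : exp 1 * κ * K₀ * (4 / 3) ≤ 1 / 2) (hA : 0 ≤ A) (K : ℕ → (ι → ℝ) → E)
    (hK0 : ∀ x, ‖K 0 x‖ ≤ A * exp ((x ⬝ᵥ M *ᵥ x) / 2))
    (hstep : ∀ j φ, K (j + 1) φ = ∫ x, K j (ofLp x + φ) ∂(multivariateGaussian 0 (Γ j))) (n : ℕ) (φ : ι → ℝ) :
    ‖K n φ‖ ≤ A * exp (exp 1 * (M * ∑ j ∈ range n, Γ j).trace) * exp (exp 1 * (φ ⬝ᵥ M *ᵥ φ) / 2) := by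
  have h := regulator_flow_summable Γ (fun j => K₀ / 4 ^ j) (fun j => exp 1 * κ * K₀ / 4 ^ j) (S := 1 / 2) hΓ hΓop
    (fun j => by positivity) hM hMκ hκ.le (schedule_pos hκ hK) (schedule_le_half hκ hK hsmall) (schedule_sum_le_half hκ hK hsmall) hA
    (schedule_subcritical hκ hK hsmall) K hK0 hstep n φ
  have he : exp (2 * (1 / 2 : ℝ)) = exp 1 := by norm_num
  rw [he] at h
  exact h

/-! ## §3. Toy -/

/-- Toy (§1): the first-scale smallness with `κ = 1∕16`, `K₀ = 1` holds: `e·(1∕16)·1·(4∕3) ≤ ½` (as `e < 3`). -/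
example : exp 1 * (1 / 16 : ℝ) * 1 * (4 / 3) ≤ 1 / 2 := by
  have he : exp 1 < 3 := lt_trans Real.exp_one_lt_d9 (by norm_num)
  nlinarith [he]

end Summit.QuantumFields.BalabanUV.T4Continuum.NE7b.SupMarginSchedule
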